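import Literature.NumberTheory.EllipticCurves.TorsionFilAtCyclicOrdinaryProofs
import Literature.NumberTheory.EllipticCurves.OrdinaryReductionTateModuleProofs
import HarnessLib

/-!
# The ordinary point from `p ∤ a_v`, and `Fil_v E[p^k]` cyclic / isotropic at a place of good ORDINARY reduction
# (theorems only; no definition, no named fact, no instance, no `sorry`)

Topic `NumberTheory/EllipticCurves` (sequel of `TorsionFilAtCyclicOrdinaryProofs`, whose theorems take the ordinary hypothesis
in the form «some `p`-torsion point of `E(K̄_v)` lies outside `E₁(K̄_v)`»; cell `pub/bsd-print-x9`, D1 road, H.4 at `v ∣ p`).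

Here that hypothesis is DERIVED from Greenberg's «good ordinary reduction at `v`»: `W.HasGoodReductionAt v` and
`p ∤ a_v = W.frobeniusTraceAt v` (Silverman, *AEC*, V.3.1(a), Ex. V.5.10(a): `Ẽ_v` has a geometric point of order `p`;
Serre 1972, §1.11: it lifts to a `p`-torsion point of `E(K̄_v)` with integral abscissa), by the recipe of
`LocalPointsOrdinaryKernelDivisibleProofs` (x10b-p1-w2): `natDegree_ΨSq_ne_zero_of_not_dvd_trace` on the reduction
`W.reductionAt v`, transported to the spectral model over the valuation ring `\bar 𝓞_v` of `|·|_v` on `K̄_v`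
(`natDegree_map_map_residue_ne_zero`), then `exists_zsmul_eq_zero_goodReductionHom_ne_zero`, read back on
`localPoints W K_v` through `localPointsEquivSpectralModel` / `mem_localKernelOfReduction_iff`.

* `WeierstrassCurve.exists_ordinaryPoint_local_of_not_dvd_frobeniusTraceAt` — the ordinary point;
* `WeierstrassCurve.exists_generator_torsionFilAt_of_not_dvd_frobeniusTraceAt` — `Fil_v E[p^k] = torsionFilAt W v (p^k)` is
  cyclic; `WeierstrassCurve.pairing_torsionFilAt_eq_zero_of_not_dvd_frobeniusTraceAt` — every bi-additive `e` on `E[p^k]` with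
  `e(a, a) = 0` vanishes on `Fil_v × Fil_v` (the `E`-level isotropy for Howard's Lemma 3.1.1 / H.4 at `v ∣ p`);
  `WeierstrassCurve.exists_generator_localKernelOfReduction_torsion_of_not_dvd_frobeniusTraceAt` (`Ê[p^k]` cyclic of order `p^k`).

References: [GreenbergLNM1716] §1 p. 62, §2 Props. 2.2, 2.4; [SilvermanAEC2009] V.3.1, VII.2.1–2.2, III.8.1;
[SerreInventiones1972] §1.11 Prop. 11; [Howard2004HeegnerKolyvagin] §3.1, Lemma 3.1.1. BSD is not proved by any of this.
-/

noncomputable section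

open scoped NNReal
open NumberField IsDedekindDomain Field Polynomial

namespace WeierstrassCurve

open Literature.NumberTheory.EllipticCurves Literature.NumberTheory.GaloisRepresentations
  IsDedekindDomain.HeightOneSpectrum AddSubgroup

universe u

variable {K : Type u} [Field K] [NumberField K] (W : WeierstrassCurve K)
  (v : HeightOneSpectrum (𝓞 K)) {p : ℕ} [hp : Fact p.Prime]

/-- **The ordinary point**: at a place `v ∋ p` of good reduction with `p ∤ a_v` (`a_v = W.frobeniusTraceAt v`) some
`p`-torsion point of `E(K̄_v)` lies outside the kernel of reduction `E₁(K̄_v)` (Greenberg's «good ordinary reduction»: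
`ker (E[p] → Ẽ[p]) ≠ E[p]`). [cite: GreenbergLNM1716, §1 p. 62 (0 → ℱ[p^∞] → E[p^∞] → Ẽ[p^∞] → 0 at an ordinary prime)]
[cite: SilvermanAEC2009, Thm. V.3.1(a) and Prop. VII.2.1] [cite: SerreInventiones1972, §1.11 Prop. 11] -/
theorem exists_ordinaryPoint_local_of_not_dvd_frobeniusTraceAt (hgood : W.HasGoodReductionAt v)
    (hpv : (p : 𝓞 K) ∈ v.asIdeal) (hord : ¬ ((p : ℤ) ∣ W.frobeniusTraceAt v)) :
    ∃ P : localPoints W (v.adicCompletion K), (p : ℤ) • P = 0 ∧ P ∉ W.localKernelOfReduction v := by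
  classical
  set L := AlgebraicClosure (v.adicCompletion K)
  let O : ValuationSubring L := (v.spectralValuation).valuationSubring
  have hvO : (v.spectralValuation).Integers O := Valuation.valuationSubring.integers _
  have hΔ : IsUnit (W.localSpectralModel v).Δ := W.isUnit_Δ_localSpectralModel hgood
  have hΔ' : IsUnit (show WeierstrassCurve O from W.localSpectralModel v).Δ := hΔ
  haveI hkv : CharP (IsLocalRing.ResidueField (v.adicCompletionIntegers K)) p :=
    ringChar.of_eq (ringChar_residueField_eq v hp.out hpv)
  haveI : CharP (IsLocalRing.ResidueField O) p := (RingHom.charP_iff_charP (v.residueFieldToSpectral) p).mp hkv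
  haveI := isElliptic_reductionAt hgood
  -- `ψ_p²` of the reduction is not constant, on `Ẽ_v` and then on the spectral model
  have hdegE : ((W.reductionAt v).ΨSq p).natDegree ≠ 0 :=
    natDegree_ΨSq_ne_zero_of_not_dvd_trace (W.reductionAt v) p (by rwa [frobeniusTraceAt_def] at hord)
  have hdegO : (((show WeierstrassCurve O from W.localSpectralModel v).ΨSq p).map
      (IsLocalRing.residue O)).natDegree ≠ 0 := by
    have h : (((W.localSpectralModel v).ΨSq p).map
        (IsLocalRing.residue (v.spectralValuation).integer)).natDegree ≠ 0 := by
      rw [localSpectralModel, WeierstrassCurve.map_ΨSq]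
      refine natDegree_map_map_residue_ne_zero (v.toSpectralInteger) _ ?_
      have hEv : W.reductionAt v =
          (W.localMinimalIntegralModel v).map (IsLocalRing.residue (v.adicCompletionIntegers K)) := rfl
      rwa [hEv, WeierstrassCurve.map_ΨSq] at hdegE
    exact h
  obtain ⟨P, hpP, hP⟩ := exists_zsmul_eq_zero_goodReductionHom_ne_zero O hvO hΔ' p hdegO
  -- read back on `E(K̄_v)`
  set T := W.localPointsEquivSpectralModel v
  set Q : ((W.localSpectralModel v).baseChange L).toAffine.Point := P with hQ
  have hQp : (p : ℤ) • Q = 0 := hpP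
  have hQred : goodReductionHom (W.localSpectralModel v) (Valuation.integer.integers v.spectralValuation) hΔ Q ≠ 0 := hP
  refine ⟨T.symm Q, T.injective (by rw [map_zsmul, AddEquiv.apply_symm_apply, hQp, map_zero]), fun hmem ↦ hQred ?_⟩
  have h := (W.mem_localKernelOfReduction_iff v (T.symm Q)).mp hmem
  rw [← goodReductionHom_eq_zero_iff (Valuation.integer.integers v.spectralValuation) hΔ] at h
  simpa [T] using h

/-- **`Ê[p^k] = E₁(K̄_v) ∩ E[p^k]` is cyclic of order `p^k` on a generator** at a place `v ∋ p` of good ordinary reduction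
(`p ∤ a_v`). [cite: GreenbergLNM1716, §1 p. 62 (ℱ[p^∞] ≅ ℚ_p/ℤ_p)] -/
theorem exists_generator_localKernelOfReduction_torsion_of_not_dvd_frobeniusTraceAt (hgood : W.HasGoodReductionAt v)
    (hpv : (p : 𝓞 K) ∈ v.asIdeal) (hord : ¬ ((p : ℤ) ∣ W.frobeniusTraceAt v)) (k : ℕ) :
    ∃ P₁ : localPoints W (v.adicCompletion K), P₁ ∈ W.localKernelOfReduction v ∧ addOrderOf P₁ = p ^ k ∧
      ∀ P : localPoints W (v.adicCompletion K), P ∈ W.localKernelOfReduction v → ((p ^ k : ℕ) : ℤ) • P = 0 →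
        ∃ c : ℕ, P = c • P₁ :=
  W.exists_generator_localKernelOfReduction_torsion v hgood hpv
    (W.exists_ordinaryPoint_local_of_not_dvd_frobeniusTraceAt v hgood hpv hord) k

/-- **`Fil_v E[p^k] = torsionFilAt W v (p^k)` is cyclic** at a place `v ∋ p` of good ordinary reduction (`p ∤ a_v`):
Howard's «`Fil_v T` has rank one» at finite level. [cite: Howard2004HeegnerKolyvagin, §3.1 (arXiv p. 15, L56–62)]
[cite: GreenbergLNM1716, §1 p. 62] -/
theorem exists_generator_torsionFilAt_of_not_dvd_frobeniusTraceAt (hgood : W.HasGoodReductionAt v)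
    (hpv : (p : 𝓞 K) ∈ v.asIdeal) (hord : ¬ ((p : ℤ) ∣ W.frobeniusTraceAt v)) (k : ℕ) :
    ∃ P₀ ∈ W.torsionFilAt v ((p : ℤ) ^ k), ∀ P ∈ W.torsionFilAt v ((p : ℤ) ^ k), ∃ c : ℤ, P = c • P₀ :=
  W.exists_generator_torsionFilAt v hgood hpv (W.exists_ordinaryPoint_local_of_not_dvd_frobeniusTraceAt v hgood hpv hord) k

/-- **`Fil_v E[p^k]` is isotropic for every bi-additive `e` on `E[p^k]` with `e(a, a) = 0`** (the Weil pairing) at a place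
`v ∋ p` of good ordinary reduction (`p ∤ a_v`) — the `E`-level input of the isotropy of Howard's ordinary condition at `v ∣ p`
(Lemma 3.1.1: «`Fil_v T_𝔭` is its own exact orthogonal complement under `e_𝔭`»).
[cite: Howard2004HeegnerKolyvagin, Lemma 3.1.1 (arXiv p. 15, L60–62)] [cite: SilvermanAEC2009, Prop. III.8.1 (e_m(T, T) = 1)] -/
theorem pairing_torsionFilAt_eq_zero_of_not_dvd_frobeniusTraceAt {P : Type*} [AddCommGroup P]
    (hgood : W.HasGoodReductionAt v) (hpv : (p : 𝓞 K) ∈ v.asIdeal) (hord : ¬ ((p : ℤ) ∣ W.frobeniusTraceAt v)) (k : ℕ)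
    (e : geomTorsion W ((p : ℤ) ^ k) →+ geomTorsion W ((p : ℤ) ^ k) →+ P) (hself : ∀ a, e a a = 0) :
    ∀ a ∈ W.torsionFilAt v ((p : ℤ) ^ k), ∀ b ∈ W.torsionFilAt v ((p : ℤ) ^ k), e a b = 0 :=
  W.pairing_torsionFilAt_eq_zero v hgood hpv (W.exists_ordinaryPoint_local_of_not_dvd_frobeniusTraceAt v hgood hpv hord)
    k e hself

end WeierstrassCurve

end
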